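import Mathlib.NumberTheory.NumberField.Discriminant.Defs
import Literature.NumberTheory.LFunctions.DedekindZeta
import Literature.NumberTheory.LFunctions.PrimeIdealTheorem
import HarnessLib

/-!
# The effective prime ideal theorem under GRH (Lagarias–Odlyzko 1977; Serre 1981, Thm. 4)

Topic `Literature/NumberTheory/LFunctions` (next to `PrimeIdealTheorem.lean`, whose named fact
`Literature.NumberTheory.LFunctions.NumberField.primeIdealTheorem` — Landau 1903, constants
depending on the field, proved in `PrimeIdealTheoremProofs.lean` — this file complements with the
GRH-conditional form whose constant is ABSOLUTE and whose dependence on the field is explicit, through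
the discriminant and the degree). One named fact, filed for the discharge of Bürgisser's reduction
modulo primes (`Literature/Computability/AlgebraicComplexity/BurgisserReductionModPrimes.lean`,
eq. (3) p. 83 of Bürgisser, *Cook's versus Valiant's hypothesis*, TCS 235 (2000): "under a
generalized Riemann hypothesis (GRH) the following effective version of the prime number theorem
for number fields is true (Weinberger [28], see also Lagarias and Odlyzko [19]):
`|π_K(x) − li(x)| = O(x^{1/2} log(|Δ| x^d))` … (The constant implicit in the `O`-term does not depend
on `g`.)").

## The source statements

* Lagarias–Odlyzko 1977, Theorem 1.1 (quoted by Serre 1981, (15_R), p. 133): if the Dedekind zeta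
  function of `E` satisfies the Riemann hypothesis then for every conjugacy class `C` of
  `G = Gal(E/K)` and every `x ≥ 2`,
  `|π_C(x) − (|C|/|G|) Li(x)| ≤ c₇ ((|C|/|G|) x^{1/2} (log d_E + n_E log x) + log d_E)`,
  `c₇` an absolute effectively computable constant, `d_E = |disc E|`, `n_E = [E : ℚ]`,
  `Li(x) = ∫₂ˣ dt/log t`, and `π_C(x)` the number of places `v` of `K` unramified in `E` with
  Frobenius class `C` and `Nv ≤ x`.
* Serre 1981, Théorème 4, (14_R), p. 133: "Il existe une constante absolue `c₆ > 0` telle que, sous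
  (GRH), on ait `|π_C(x) − (|C|/|G|) Li(x)| ≤ c₆ (|C|/|G|) x^{1/2} (log d_E + n_E log x)` pour tout
  `x ≥ 2`", with Remarque 1, p. 134: "pour prouver (14_R), il n'est pas nécessaire de supposer que
  (GRH) soit vraie : il suffit (et il faut...) que la fonction zêta du corps `E` considéré n'ait pas
  de zéro de partie réelle `> 1/2`."

We vendor the special case `E = K`, `G = C = {1}` (every place is unramified, `π_C = π_K` counts all
nonzero prime ideals of norm `≤ x`): there `(15_R)` already gives `(14_R)` with `c₆ = 2c₇`, since
`log d_K ≤ x^{1/2} log d_K` for `x ≥ 1`.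

## Content (namespace `Literature.NumberTheory.LFunctions.NumberField`)

* `effectivePrimeIdealTheorem_of_ERH` — NAMED FACT: there is an absolute `c > 0` such that for
  every number field `K` with `NumberField.ExtendedRiemannHypothesis K` (every zero of the continued
  Dedekind zeta function `dedekindZetaCont K` in the open critical strip lies on `Re s = 1/2`;
  `DedekindZeta.lean`, meaningful by Hecke's theorem `exists_isDedekindZetaContinuation_holds` of
  `DedekindZetaThetaProofs.lean`) and every real `x ≥ 2`,
  `|π_K(x) − Li(x)| ≤ c √x (log |d_K| + [K : ℚ] log x)`,
  with `π_K = primeIdealCount K` (`PrimeIdealTheorem.lean`), `Li = offsetLogIntegral`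
  (`LogIntegral.lean`), `d_K = NumberField.discr K` (Mathlib).
* `effectivePrimeIdealTheorem_of_ERH.of_extendedRiemannHypothesis` — the same under the universal
  hypothesis `Literature.NumberTheory.LFunctions.ExtendedRiemannHypothesis` (trivial corollary, proved).

## Design choices

* The hypothesis is the strip form `NumberField.ExtendedRiemannHypothesis K` of `DedekindZeta.lean`;
  it implies the hypothesis actually needed ("no zero of real part `> 1/2`", Serre's Remarque 1),
  the closed half-plane `Re s ≥ 1` being zero-free unconditionally
  (`dedekindZetaCont_ne_zero_of_one_le_re_holds`, `DedekindZetaNonvanishing.lean`). A stronger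
  hypothesis makes a weaker (safer) fact.
* `K : Type` (universe `0`) inside the `Prop`, as in `primeIdealTheorem`; every number field is
  isomorphic to one in `Type` (`ℚ[X]/(f)`).
* Not vendored: the general Chebotarev form (`π_C` for a Galois extension `E/K` needs the Frobenius
  class of a place, not in Mathlib in this form), the unconditional Theorem 1.3 of Lagarias–Odlyzko,
  Oesterlé's value `c₆ = 2` (Serre, Remarque 2, unpublished).
* Triage of the discharge: XL — it is Lagarias–Odlyzko's paper (Hadamard factorisation of `ξ_E`,
  zero density `n_E(t) ≪ log d_E + n_E log(|t| + 2)`, uniform bounds for `ζ_E'/ζ_E`, an explicit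
  formula with a truncated kernel), none of it in Mathlib; the tree has the field-by-field
  ingredients (Hecke's continuation, the classical zero-free region, `ψ_K(x) = x + O_K(x e^{−c√log x})`)
  but not the uniformity in `(d_E, n_E)`.

## References

* J. C. Lagarias, A. M. Odlyzko, *Effective versions of the Chebotarev density theorem*, in:
  Algebraic Number Fields (Durham 1975), Academic Press 1977, 409–464, Theorem 1.1
  (`LagariasOdlyzko1977`).
* J.-P. Serre, *Quelques applications du théorème de densité de Chebotarev*, Publ. Math. IHÉS 54
  (1981), 123–201, §2.4, Théorème 4, (14_R)–(15_R), p. 133, and Remarque 1, p. 134 (`Serre1981`).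
* P. Bürgisser, *Cook's versus Valiant's hypothesis*, Theoret. Comput. Sci. 235 (2000) 71–88,
  eq. (3) p. 83 (`Burgisser2000TCS`).
-/

noncomputable section

open scoped NumberField

namespace Literature.NumberTheory.LFunctions.NumberField

/-- **The effective prime ideal theorem under GRH** (Lagarias–Odlyzko 1977, Theorem 1.1, in the
form of Serre 1981, Théorème 4, (14_R), for the trivial extension `E = K`, `C = G = {1}`): there is
an absolute constant `c > 0` such that for every number field `K` whose (continued) Dedekind zeta
function satisfies the Riemann hypothesis and every real `x ≥ 2`,
`|π_K(x) − Li(x)| ≤ c · x^{1/2} · (log |d_K| + [K : ℚ] · log x)`,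
where `π_K(x)` is the number of nonzero prime ideals of `𝓞 K` of absolute norm `≤ x`
(`primeIdealCount`), `Li(x) = ∫₂ˣ dt/log t` (`offsetLogIntegral`) and `d_K` is the discriminant
of `K`. Serre: "Il existe une constante absolue `c₆ > 0` telle que, sous (GRH), on ait
`|π_C(x) − (|C|/|G|) Li(x)| ≤ c₆ (|C|/|G|) x^{1/2}(log d_E + n_E log x)` pour tout `x ≥ 2`"; for `E = K`
this is Lagarias–Odlyzko's (15_R) with the term `c₇ log d_E ≤ c₇ x^{1/2} log d_E` absorbed. The
hypothesis used is the strip form `NumberField.ExtendedRiemannHypothesis K`, which implies Serre's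
"la fonction zêta du corps `E` considéré n'ait pas de zéro de partie réelle `> 1/2`" (Remarque 1,
p. 134). This is eq. (3), p. 83, of Bürgisser 2000 (there with `Δ`, `d` for `d_K`, `[K : ℚ]`).
[cite: Serre1981, Thm. 4 (14_R) p. 133] -/
def effectivePrimeIdealTheorem_of_ERH : Prop :=
  ∃ c : ℝ, 0 < c ∧ ∀ (K : Type) [Field K] [NumberField K],
    NumberField.ExtendedRiemannHypothesis K → ∀ x : ℝ, 2 ≤ x →
      |(primeIdealCount K x : ℝ) - offsetLogIntegral x| ≤
        c * Real.sqrt x *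
          (Real.log |(_root_.NumberField.discr K : ℝ)| + Module.finrank ℚ K * Real.log x)

/-- Under the Extended Riemann Hypothesis for all number fields
(`Literature.NumberTheory.LFunctions.ExtendedRiemannHypothesis`), the effective prime ideal theorem
holds for every number field `K : Type` with one absolute constant (immediate from
`effectivePrimeIdealTheorem_of_ERH`). [cite: Serre1981, Thm. 4 (14_R) p. 133] -/
theorem effectivePrimeIdealTheorem_of_ERH.of_extendedRiemannHypothesis
    (h : effectivePrimeIdealTheorem_of_ERH)
    (hERH : Literature.NumberTheory.LFunctions.ExtendedRiemannHypothesis) :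
    ∃ c : ℝ, 0 < c ∧ ∀ (K : Type) [Field K] [NumberField K], ∀ x : ℝ, 2 ≤ x →
      |(primeIdealCount K x : ℝ) - offsetLogIntegral x| ≤
        c * Real.sqrt x *
          (Real.log |(_root_.NumberField.discr K : ℝ)| + Module.finrank ℚ K * Real.log x) := by
  obtain ⟨c, hc, h⟩ := h
  exact ⟨c, hc, fun K _ _ x hx => h K (hERH K) x hx⟩

end Literature.NumberTheory.LFunctions.NumberField

end
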